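import Mathlib.Analysis.SpecialFunctions.Complex.Circle
import Mathlib.Analysis.InnerProductSpace.PiL2
import Literature.Topology.FourManifolds.CappellShanesonWang
import Literature.AlgebraicTopology.SingularHomology.HOneProducts
import Literature.AlgebraicTopology.SingularHomology.SphereHomology
import HarnessLib

/-!
# `H₁` of the 3-torus with its `SL(3, ℤ)`-action (the degree-one half of the torus input of
# Cappell–Shaneson)

The named fact `Literature.Topology.FourManifolds.singularHomology_threeTorus_linear`
(`CappellShanesonWang.lean`; A. Hatcher, *Algebraic Topology* (2002), §3.C Exercise 11 and
Example 3.16) is the last torus-specific leaf of the decomposition of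
`Literature.Topology.FourManifolds.nonempty_homotopyEquiv_sphere_four_of_isCappellShanesonSphere`
(S. E. Cappell, J. L. Shaneson, *Some new four-manifolds*, Ann. of Math. 104 (1976), §2). It asks for
isomorphisms `H₁(T³; ℤ) ≅ ℤ³`, `H₂(T³; ℤ) ≅ ℤ³` conjugating the linear torus map `torusMap A`,
`A ∈ SL(3, ℤ)`, to `A` resp. `(A⁻¹)ᵀ`. This file **proves the degree-one half**:

* `Literature.Topology.FourManifolds.circleHomeomorphSphereOne`: Mathlib's circle group
  `Circle ⊆ ℂ` is homeomorphic to the unit sphere `𝕊¹ ⊆ ℝ²`, whence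
  `Literature.Topology.FourManifolds.singularHomologyOneCircleIso : H₁(Circle; ℤ) ≅ ℤ`
  (Hatcher Cor. 2.14, proved in the tree: `nonempty_singularHomology_sphere_iso_holds`).
* `Literature.Topology.FourManifolds.ThreeTorus.proj i`, `….incl j`: the coordinate circles of
  `T³ = S¹ × S¹ × S¹` and the two identities driving everything: in the commutative topological
  group `C(T³, T³)` the identity map is the pointwise product `∏ⱼ inclⱼ ∘ projⱼ`
  (`prod_incl_comp_proj`), and `projᵢ ∘ torusMap A = ∏ⱼ projⱼ ^ Aᵢⱼ` in `C(T³, S¹)`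
  (`proj_comp_torusMapC`, the definition of the monomial map).
* By the additivity `(f · g)_* = f_* + g_*` on `H₁(-; ℤ)` for maps into a path-connected
  topological group (Hatcher §3.C, Lemma 3C.3 / Ex. 5, proved in `…SingularHomology.HOneProducts`
  from the Hurewicz theorem 2A.1): `𝟙 = Σⱼ (projⱼ)_* ≫ (inclⱼ)_*` on `H₁(T³; ℤ)`
  (`sum_map_proj_comp_map_incl`) and `(torusMap A)_* ≫ (projᵢ)_* = Σⱼ Aᵢⱼ • (projⱼ)_*`
  (`map_torusMapC_comp_map_proj`).
* `Literature.Topology.FourManifolds.singularHomologyOneThreeTorusIso : H₁(T³; ℤ) ≅ ℤ³`,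
  `y ↦ (θ (projᵢ)_* y)ᵢ` with inverse `v ↦ Σⱼ (inclⱼ)_* θ⁻¹ vⱼ`, and
  **`Literature.Topology.FourManifolds.map_torusMapC_one_comp_iso`**:
  `(torusMap A)_* ≫ β₁ = β₁ ≫ (v ↦ A v)` for every `A ∈ SL(3, ℤ)` — the `H₁` conjunct of
  `singularHomology_threeTorus_linear`, verbatim (`exists_iso_singularHomology_one_threeTorus`).

Everything here is proved; the only new data are the homeomorphism, the coordinate maps and the
two isomorphisms.

## References

* A. Hatcher, *Algebraic Topology*, CUP 2002, §2.2 Cor. 2.14; §2.A Thm. 2A.1; §3.B Thm. 3B.6;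
  §3.C Lemma 3C.3, Exercise 11, Example 3.16 [HatcherAT2002].
* S. E. Cappell, J. L. Shaneson, *Some new four-manifolds*, Ann. of Math. 104 (1976) 61–72, §2
  [CappellShanesonAnnals1976].
-/

noncomputable section

open CategoryTheory Limits
open Literature.AlgebraicTopology.SingularHomology

namespace Literature.Topology.FourManifolds

/-- Local notation: `𝕊 n` is the unit sphere in `EuclideanSpace ℝ (Fin (n + 1))`. -/
local notation "𝕊 " n:arg => (Metric.sphere (0 : EuclideanSpace ℝ (Fin (n + 1))) 1)

/-! ### `H₁` of the circle group -/

/-- The image of the unit circle of `ℂ` under the canonical isometry `ℂ ≃ ℝ²` is the unit circle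
of `ℝ²`. [folklore] -/
theorem image_orthonormalBasisOneI_sphere :
    (Complex.orthonormalBasisOneI.repr.toHomeomorph : ℂ ≃ₜ EuclideanSpace ℝ (Fin 2)) ''
        Metric.sphere (0 : ℂ) 1 = 𝕊 1 := by
  have h := Complex.orthonormalBasisOneI.repr.toIsometryEquiv.image_sphere 0 1
  rw [LinearIsometryEquiv.coe_toIsometryEquiv, map_zero] at h
  exact h

/-- **Mathlib's circle group `Circle ⊆ ℂ` is homeomorphic to the unit sphere `𝕊¹ ⊆ ℝ²`** (the
space whose homology the tree computes), through the isometry `ℂ ≃ ℝ²`, `z ↦ (re z, im z)`.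
[folklore] -/
def circleHomeomorphSphereOne : Circle ≃ₜ 𝕊 1 :=
  ((Complex.orthonormalBasisOneI.repr.toHomeomorph.image (Metric.sphere (0 : ℂ) 1)).trans
    (Homeomorph.setCongr image_orthonormalBasisOneI_sphere) : ↥(Metric.sphere (0 : ℂ) 1) ≃ₜ 𝕊 1)

/-- **`H₁(S¹; ℤ) ≅ ℤ` for the circle group** (Hatcher 2002, Cor. 2.14, `H₁(𝕊¹) ≅ ℤ`, proved in the
tree as `nonempty_singularHomology_sphere_iso_holds`), transported along
`circleHomeomorphSphereOne`. [cite: HatcherAT2002, Cor. 2.14] -/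
def singularHomologyOneCircleIso : singularHomology ℤ ℤ Circle 1 ≅ ModuleCat.of ℤ ℤ :=
  singularHomology.mapIso ℤ ℤ circleHomeomorphSphereOne 1 ≪≫
    (nonempty_singularHomology_sphere_iso_holds ℤ ℤ (n := 1) le_rfl).some ≪≫
      (ULift.moduleEquiv : ULift.{0} ℤ ≃ₗ[ℤ] ℤ).toModuleIso

/-! ### Coordinate circles of `T³` -/

namespace ThreeTorus

/-- The `i`-th coordinate projection `T³ → S¹`, `z ↦ zᵢ`, as a continuous map. [folklore] -/
def proj (i : Fin 3) : C(ThreeTorus, Circle) :=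
  ⟨fun z ↦ torusCoord z i, (contMDiff_torusCoord i).continuous⟩

/-- Values of `proj`. [folklore] -/
@[simp] theorem proj_apply (i : Fin 3) (z : ThreeTorus) : proj i z = torusCoord z i := rfl

/-- The `j`-th coordinate circle `S¹ → T³` (the other two coordinates equal to `1`), as a
continuous map. [folklore] -/
def incl : Fin 3 → C(Circle, ThreeTorus) :=
  ![⟨fun z ↦ (z, 1, 1), by fun_prop⟩, ⟨fun z ↦ (1, z, 1), by fun_prop⟩,
    ⟨fun z ↦ (1, 1, z), by fun_prop⟩]

/-- Values of `incl 0`. [folklore] -/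
@[simp] theorem incl_zero_apply (z : Circle) : incl 0 z = (z, 1, 1) := rfl
/-- Values of `incl 1`. [folklore] -/
@[simp] theorem incl_one_apply (z : Circle) : incl 1 z = (1, z, 1) := rfl
/-- Values of `incl 2`. [folklore] -/
@[simp] theorem incl_two_apply (z : Circle) : incl 2 z = (1, 1, z) := rfl

/-- `projᵢ ∘ inclᵢ = id`. [folklore] -/
theorem proj_comp_incl_self (i : Fin 3) : (proj i).comp (incl i) = ContinuousMap.id Circle := by
  ext z : 1
  fin_cases i <;> rfl

/-- `projᵢ ∘ inclⱼ` is constant for `i ≠ j`. [folklore] -/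
theorem proj_comp_incl_of_ne {i j : Fin 3} (h : i ≠ j) :
    (proj i).comp (incl j) = ContinuousMap.const Circle 1 := by
  ext z : 1
  fin_cases i <;> fin_cases j <;> first | exact absurd rfl h | rfl

/-- **The identity of `T³` is the pointwise product of its coordinate retractions**:
`∏ⱼ inclⱼ ∘ projⱼ = id` in the commutative group `C(T³, T³)`, i.e.
`(z₀, z₁, z₂) = (z₀, 1, 1) · (1, z₁, 1) · (1, 1, z₂)`. [folklore] -/
theorem prod_incl_comp_proj : ∏ j, (incl j).comp (proj j) = ContinuousMap.id ThreeTorus := by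
  ext z : 1
  obtain ⟨a, b, c⟩ := z
  rw [ContinuousMap.prod_apply, Fin.prod_univ_three]
  change ((a, 1, 1) : ThreeTorus) * (1, b, 1) * (1, 1, c) = (a, b, c)
  simp only [Prod.mk_mul_mk, mul_one, one_mul]

/-- **The coordinates of the linear torus map are monomials**:
`projᵢ ∘ torusMap A = ∏ⱼ projⱼ ^ Aᵢⱼ` in the commutative group `C(T³, S¹)` (the definition of
`torusMap`, Cappell–Shaneson 1976, §2). [cite: CappellShanesonAnnals1976, §2] -/
theorem proj_comp_torusMapC (A : Matrix.SpecialLinearGroup (Fin 3) ℤ) (i : Fin 3) :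
    (proj i).comp (torusMapC A) = ∏ j, proj j ^ (A.1 i j) := by
  ext z : 1
  change torusCoord (torusMap A.1 z) i = (∏ j, proj j ^ (A.1 i j)) z
  rw [torusCoord_torusMap, ContinuousMap.prod_apply]
  simp only [ContinuousMap.zpow_apply, proj_apply]
  rfl

/-! ### The two identities on `H₁(T³; ℤ)` -/

/-- **`𝟙 = Σⱼ (projⱼ)_* ≫ (inclⱼ)_*` on `H₁(T³; ℤ)`**: apply the additivity of `H₁` for maps into the
path-connected commutative topological group `T³` (`singularHomology.map_prod_one`, Hatcher §3.C
Lemma 3C.3 with Thm. 2A.1) to `id = ∏ⱼ inclⱼ ∘ projⱼ`. [cite: HatcherAT2002, §3.C Lemma 3C.3] -/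
theorem sum_map_proj_comp_map_incl :
    ∑ j, singularHomology.map ℤ ℤ (proj j) 1 ≫ singularHomology.map ℤ ℤ (incl j) 1 =
      𝟙 (singularHomology ℤ ℤ ThreeTorus 1) := by
  have h := singularHomology.map_prod_one (X := ThreeTorus) (G := ThreeTorus) Finset.univ
    fun j ↦ (incl j).comp (proj j)
  rw [prod_incl_comp_proj, singularHomology.map_id] at h
  rw [h]
  refine Finset.sum_congr rfl fun j _ ↦ ?_
  rw [singularHomology.map_comp]

/-- **`(torusMap A)_* ≫ (projᵢ)_* = Σⱼ Aᵢⱼ • (projⱼ)_*` on `H₁(T³; ℤ)`**: the `i`-th coordinate of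
`torusMap A` is the monomial `∏ⱼ zⱼ ^ Aᵢⱼ`, and `(∏ⱼ fⱼ ^ kⱼ)_* = Σⱼ kⱼ • (fⱼ)_*` for maps into the
circle group (`singularHomology.map_prod_one`, `singularHomology.map_zpow_one`; Hatcher §3.C
Exercise 11: the coordinate circle `j` goes to the loop of class the `j`-th column of `A`).
[cite: HatcherAT2002, §3.C Exercise 11] -/
theorem map_torusMapC_comp_map_proj (A : Matrix.SpecialLinearGroup (Fin 3) ℤ) (i : Fin 3) :
    singularHomology.map ℤ ℤ (torusMapC A) 1 ≫ singularHomology.map ℤ ℤ (proj i) 1 =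
      ∑ j, A.1 i j • singularHomology.map ℤ ℤ (proj j) 1 := by
  rw [← singularHomology.map_comp, proj_comp_torusMapC, singularHomology.map_prod_one]
  refine Finset.sum_congr rfl fun j _ ↦ ?_
  rw [singularHomology.map_zpow_one]

/-- `(inclⱼ)_* ≫ (projⱼ)_* = 𝟙` on `H₁(S¹; ℤ)`. [folklore] -/
theorem map_incl_comp_map_proj_self (j : Fin 3) :
    singularHomology.map ℤ ℤ (incl j) 1 ≫ singularHomology.map ℤ ℤ (proj j) 1 = 𝟙 _ := by
  rw [← singularHomology.map_comp, proj_comp_incl_self, singularHomology.map_id]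

/-- `(inclⱼ)_* ≫ (projᵢ)_* = 0` on `H₁(S¹; ℤ)` for `i ≠ j` (a constant map kills `H₁`,
Hatcher Prop. 2.8). [cite: HatcherAT2002, Prop. 2.8] -/
theorem map_incl_comp_map_proj_of_ne {i j : Fin 3} (h : i ≠ j) :
    singularHomology.map ℤ ℤ (incl j) 1 ≫ singularHomology.map ℤ ℤ (proj i) 1 = 0 := by
  rw [← singularHomology.map_comp, proj_comp_incl_of_ne h,
    singularHomology.map_const ℤ ℤ _ one_ne_zero]

end ThreeTorus

/-! ### `H₁(T³; ℤ) ≅ ℤ³` and the action of `SL(3, ℤ)` -/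

open ThreeTorus

/-- The coordinate map `H₁(T³; ℤ) → ℤ³`, `y ↦ (θ((projᵢ)_* y))ᵢ` with `θ : H₁(S¹; ℤ) ≅ ℤ`
(Hatcher 2002, §3.C Exercise 11: `H₁(T³) = ℤ³` on the coordinate circles). [cite: HatcherAT2002, §3.C Exercise 11] -/
def homologyOneCoord : singularHomology ℤ ℤ ThreeTorus 1 ⟶ ModuleCat.of ℤ (Fin 3 → ℤ) :=
  ModuleCat.ofHom (LinearMap.pi fun i ↦
    (singularHomology.map ℤ ℤ (proj i) 1 ≫ singularHomologyOneCircleIso.hom).hom)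

/-- Values of `homologyOneCoord`. [folklore] -/
theorem homologyOneCoord_apply (y : singularHomology ℤ ℤ ThreeTorus 1) (i : Fin 3) :
    homologyOneCoord y i =
      singularHomologyOneCircleIso.hom (singularHomology.map ℤ ℤ (proj i) 1 y) := rfl

/-- The inverse coordinate map `ℤ³ → H₁(T³; ℤ)`, `v ↦ Σⱼ (inclⱼ)_* θ⁻¹(vⱼ)`. [folklore] -/
def homologyOneCoordInv : ModuleCat.of ℤ (Fin 3 → ℤ) ⟶ singularHomology ℤ ℤ ThreeTorus 1 :=
  ModuleCat.ofHom (∑ j, (singularHomologyOneCircleIso.inv ≫ singularHomology.map ℤ ℤ (incl j) 1).hom ∘ₗ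
    LinearMap.proj j)

/-- Values of `homologyOneCoordInv`. [folklore] -/
theorem homologyOneCoordInv_apply (v : Fin 3 → ℤ) :
    homologyOneCoordInv v =
      ∑ j, singularHomology.map ℤ ℤ (incl j) 1 (singularHomologyOneCircleIso.inv (v j)) := by
  change (∑ j, (singularHomologyOneCircleIso.inv ≫ singularHomology.map ℤ ℤ (incl j) 1).hom ∘ₗ
    LinearMap.proj j) v = _
  rw [LinearMap.sum_apply]
  rfl

/-- **`H₁(T³; ℤ) ≅ ℤ³`** (Hatcher 2002, §3.C Exercise 11 / Example 3.16; here from the degree-one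
Künneth-type identity `𝟙 = Σⱼ (projⱼ)_* ≫ (inclⱼ)_*` and `H₁(S¹; ℤ) ≅ ℤ`): the coordinate map
`homologyOneCoord` with inverse `homologyOneCoordInv`. [cite: HatcherAT2002, §3.C Exercise 11] -/
def singularHomologyOneThreeTorusIso :
    singularHomology ℤ ℤ ThreeTorus 1 ≅ ModuleCat.of ℤ (Fin 3 → ℤ) where
  hom := homologyOneCoord
  inv := homologyOneCoordInv
  hom_inv_id := by
    ext y
    change homologyOneCoordInv (homologyOneCoord y) = y
    rw [homologyOneCoordInv_apply]
    have h : ∀ j, singularHomology.map ℤ ℤ (incl j) 1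
        (singularHomologyOneCircleIso.inv (homologyOneCoord y j)) =
        (singularHomology.map ℤ ℤ (proj j) 1 ≫ singularHomology.map ℤ ℤ (incl j) 1).hom y := fun j ↦ by
      rw [homologyOneCoord_apply, Iso.hom_inv_id_apply, ModuleCat.hom_comp, LinearMap.comp_apply]
    rw [Finset.sum_congr rfl fun j _ ↦ h j, ← LinearMap.sum_apply, ← ModuleCat.hom_sum,
      sum_map_proj_comp_map_incl]
    rfl
  inv_hom_id := by
    apply ModuleCat.hom_ext
    refine LinearMap.ext fun v ↦ funext fun i ↦ ?_
    change homologyOneCoord (homologyOneCoordInv v) i = v i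
    rw [homologyOneCoord_apply, homologyOneCoordInv_apply, map_sum, map_sum]
    have h : ∀ j, singularHomologyOneCircleIso.hom (singularHomology.map ℤ ℤ (proj i) 1
        (singularHomology.map ℤ ℤ (incl j) 1 (singularHomologyOneCircleIso.inv (v j)))) =
        if i = j then v j else 0 := fun j ↦ by
      rw [← ModuleCat.comp_apply (singularHomology.map ℤ ℤ (incl j) 1)
        (singularHomology.map ℤ ℤ (proj i) 1)]
      split_ifs with hij
      · subst hij
        rw [map_incl_comp_map_proj_self, ModuleCat.id_apply, Iso.inv_hom_id_apply]
      · rw [map_incl_comp_map_proj_of_ne hij]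
        change singularHomologyOneCircleIso.hom
          ((0 : singularHomology ℤ ℤ Circle 1 ⟶ singularHomology ℤ ℤ Circle 1).hom _) = 0
        rw [ModuleCat.hom_zero, LinearMap.zero_apply, map_zero]
    rw [Finset.sum_congr rfl fun j _ ↦ h j, Finset.sum_ite_eq, if_pos (Finset.mem_univ i)]

/-- **The action of `SL(3, ℤ)` on `H₁(T³; ℤ) ≅ ℤ³` is the standard one**:
`(torusMap A)_* ≫ β₁ = β₁ ≫ (v ↦ A v)` (Hatcher 2002, §3.C Exercise 11; Cappell–Shaneson 1976,
§2: "`A - 1` on `H₁(T³) = ℤ³`"). [cite: HatcherAT2002, §3.C Exercise 11] -/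
theorem map_torusMapC_one_comp_iso (A : Matrix.SpecialLinearGroup (Fin 3) ℤ) :
    singularHomology.map ℤ ℤ (torusMapC A) 1 ≫ singularHomologyOneThreeTorusIso.hom =
      singularHomologyOneThreeTorusIso.hom ≫ ModuleCat.ofHom (Matrix.mulVecLin A.1) := by
  apply ModuleCat.hom_ext
  refine LinearMap.ext fun y ↦ funext fun i ↦ ?_
  change homologyOneCoord (singularHomology.map ℤ ℤ (torusMapC A) 1 y) i =
    Matrix.mulVec (A : Matrix (Fin 3) (Fin 3) ℤ) (homologyOneCoord y) i
  rw [homologyOneCoord_apply, ← ModuleCat.comp_apply (singularHomology.map ℤ ℤ (torusMapC A) 1)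
    (singularHomology.map ℤ ℤ (proj i) 1), map_torusMapC_comp_map_proj, Matrix.mulVec, dotProduct]
  change singularHomologyOneCircleIso.hom
    ((∑ j, A.1 i j • singularHomology.map ℤ ℤ (proj j) 1).hom y) = _
  rw [ModuleCat.hom_sum, LinearMap.sum_apply, map_sum]
  refine Finset.sum_congr rfl fun j _ ↦ ?_
  change singularHomologyOneCircleIso.hom (A.1 i j • singularHomology.map ℤ ℤ (proj j) 1 y) =
    A.1 i j * homologyOneCoord y j
  rw [map_zsmul, homologyOneCoord_apply, smul_eq_mul]

/-- **The degree-one half of `singularHomology_threeTorus_linear`, verbatim**: an isomorphism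
`β₁ : H₁(T³; ℤ) ≅ ℤ³` with `(torusMap A)_* ≫ β₁ = β₁ ≫ (v ↦ A v)` for all `A ∈ SL(3, ℤ)`
(Hatcher 2002, §3.C Exercise 11). [cite: HatcherAT2002, §3.C Exercise 11] -/
theorem exists_iso_singularHomology_one_threeTorus :
    ∃ β₁ : singularHomology ℤ ℤ ThreeTorus 1 ≅ ModuleCat.of ℤ (Fin 3 → ℤ),
      ∀ A : Matrix.SpecialLinearGroup (Fin 3) ℤ,
        singularHomology.map ℤ ℤ (torusMapC A) 1 ≫ β₁.hom =
          β₁.hom ≫ ModuleCat.ofHom (Matrix.mulVecLin A.1) :=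
  ⟨singularHomologyOneThreeTorusIso, map_torusMapC_one_comp_iso⟩

end Literature.Topology.FourManifolds

end
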